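import Summits.NavierStokesRegularity.NavierStokesRegularity.Theorems.SoloRefuteShahmurov2026Prop52ConcreteKernel

/-!
# D-0090 NS-CLAIMS, claim C11 `Shahmurov2026` (T = arXiv:2605.09797 v2), row #11 — BY-SLOT record, support
# block 2/3: the profile pair `(gU, hU)` — `J₂[gU,hU] < 0`, `W[hU] > 0` for every core cut-off; amplitude scaling

Support block for `Theorems/SoloRefuteShahmurov2026Prop52Concrete.lean` (records-grade, by-slot of #11; chair
RULINGS 2026-08-27T08:12Z (1)). (D) two axial radial bumps of radii `1/10 < 1/5`, `gU` centred at `+½e₄` and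
`hU ≥ 0` centred at `−½e₄`, both `SO(4)`-radial, smooth, supported in the unit core `‖x‖ ≤ 1`, with the `z`-gap:
every point of `supp hU` (indeed of the auxiliary cut-off `ψU ≡ 1` on it) lies strictly below every point of
`supp gU` (`zgap`); (E) hence on `supp ψU` the recovered strain `U[gU]` (T eq. (2.5) p.9; the skeleton's
`recoveredStrain`) is a continuous nonpositive function (`ΦU = ψU·U[gU]`: ONE parametric integral with a jointly
continuous integrand, uniformly compactly supported in `y` — the kernel singularity never meets
`supp ψU × supp gU`), strictly negative at the centre of `hU` (`ΦU_cH_neg`); (F) for EVERY cut-off `χ` with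
`χ ≡ 1` on the unit core (T p.8 l.315–319): `J₂[gU,hU] = ∫χ²U[gU]hU² < 0` (`transferH_neg`) and
`W[hU] ≥ ∫|∇hU|² > 0` (`visibility_hU_pos`), in the paper's functionals `transferH` / `visibility` (T §5 p.14
l.695–711); (G) the elementary amplitude choice `scaling_algebra`: `a²V + βb²W = 1`, `a³J₁ − αab²J₂ > 0`.
WHAT THIS IS NOT: not a claim about NS regularity or blow-up; not a claim about any author beyond the typed
locator.
-/

noncomputable section

-- The summit's canonical theorem namespace repeats the summit name (single-conjunct summit).
set_option linter.dupNamespace false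

namespace Summit.NavierStokesRegularity.NavierStokesRegularity.Theorems.Shahmurov2026.Concrete

open MeasureTheory Set Filter Topology Metric
open Literature.Claims.NS.Shahmurov2026
open Literature.Analysis.PDE

/-! ### D. The profile pair: two axial bumps inside the unit core, `z`-separated -/

/-- Centre of the `G`-profile bump, `+½e₄`. -/
def cG : E5 := (1 / 2 : ℝ) • e₄

/-- Centre of the `H`-profile bump, `−½e₄`. -/
def cH : E5 := (-(1 / 2) : ℝ) • e₄

/-- `(cG)_z = ½`. -/
theorem cG_four : cG 4 = 1 / 2 := smul_e₄_apply_four _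

/-- `(cH)_z = −½`. -/
theorem cH_four : cH 4 = -(1 / 2) := smul_e₄_apply_four _

/-- `‖cG‖ = ½`. -/
theorem norm_cG : ‖cG‖ = 1 / 2 := by rw [cG, norm_smul_e₄]; norm_num

/-- `‖cH‖ = ½`. -/
theorem norm_cH : ‖cH‖ = 1 / 2 := by rw [cH, norm_smul_e₄]; norm_num

/-- Numeric side condition `0 ≤ 1/10`. -/
private theorem n₁ : (0 : ℝ) ≤ 1 / 10 := by norm_num
/-- Numeric side condition `1/10 < 1/5`. -/
private theorem n₂ : (1 / 10 : ℝ) < 1 / 5 := by norm_num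
/-- Numeric side condition `0 ≤ 1/4`. -/
private theorem n₃ : (0 : ℝ) ≤ 1 / 4 := by norm_num
/-- Numeric side condition `1/4 < 1/3`. -/
private theorem n₄ : (1 / 4 : ℝ) < 1 / 3 := by norm_num

/-- The unit `G`-profile: the axial bump of radii `1/10 < 1/5` about `+½e₄`. -/
def gU : E5 → ℝ := bump cG (1 / 10) (1 / 5)

/-- The unit `H`-profile (source density, `≥ 0`): the axial bump of radii `1/10 < 1/5` about `−½e₄`. -/
def hU : E5 → ℝ := bump cH (1 / 10) (1 / 5)

/-- Auxiliary cut-off `≡ 1` on the support of `hU`, supported in `closedBall (−½e₄) (1/3)`. -/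
def ψU : E5 → ℝ := bump cH (1 / 4) (1 / 3)

/-- Unfolding lemma for `gU`. -/
theorem gU_def : gU = bump cG (1 / 10) (1 / 5) := rfl
/-- Unfolding lemma for `hU`. -/
theorem hU_def : hU = bump cH (1 / 10) (1 / 5) := rfl
/-- Unfolding lemma for `ψU`. -/
theorem ψU_def : ψU = bump cH (1 / 4) (1 / 3) := rfl

/-- `gU` is `SO(4)`-radial. -/
theorem isSO4Radial_gU : IsSO4Radial gU := isSO4Radial_bump _ _ _
/-- `hU` is `SO(4)`-radial. -/
theorem isSO4Radial_hU : IsSO4Radial hU := isSO4Radial_bump _ _ _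
/-- `hU ≥ 0` (a source DENSITY). -/
theorem hU_nonneg (x : E5) : 0 ≤ hU x := bump_nonneg _ _ _ _
/-- `gU ≥ 0`. -/
theorem gU_nonneg (x : E5) : 0 ≤ gU x := bump_nonneg _ _ _ _
/-- `ψU ≥ 0`. -/
theorem ψU_nonneg (x : E5) : 0 ≤ ψU x := bump_nonneg _ _ _ _
/-- `gU` is smooth. -/
theorem contDiff_gU {n : ℕ∞} : ContDiff ℝ n gU := contDiff_bump _ _ _
/-- `hU` is smooth. -/
theorem contDiff_hU {n : ℕ∞} : ContDiff ℝ n hU := contDiff_bump _ _ _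
/-- `gU` has compact support. -/
theorem hasCompactSupport_gU : HasCompactSupport gU := hasCompactSupport_bump n₁ n₂
/-- `hU` has compact support. -/
theorem hasCompactSupport_hU : HasCompactSupport hU := hasCompactSupport_bump n₁ n₂

/-- Points of `closedBall cH (1/3)` have `z ≤ −1/6`. -/
theorem four_le_of_near_cH {x : E5} (hx : ‖x - cH‖ ≤ 1 / 3) : x 4 ≤ -(1 / 6) := by
  have h := abs_sub_four_le x cH
  rw [cH_four] at h
  have := (abs_le.1 (h.trans hx)).2
  linarith

/-- Points of `closedBall cG (1/5)` have `z ≥ 3/10`. -/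
theorem four_ge_of_near_cG {y : E5} (hy : ‖y - cG‖ ≤ 1 / 5) : 3 / 10 ≤ y 4 := by
  have h := abs_sub_four_le y cG
  rw [cG_four] at h
  have := (abs_le.1 (h.trans hy)).1
  linarith

/-- The `z`-gap: every point of `supp ψU ⊇ supp hU` lies strictly BELOW every point of `supp gU`. -/
theorem zgap {x y : E5} (hx : ‖x - cH‖ ≤ 1 / 3) (hy : ‖y - cG‖ ≤ 1 / 5) : (x - y) 4 < 0 := by
  rw [PiLp.sub_apply]
  linarith [four_le_of_near_cH hx, four_ge_of_near_cG hy]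

/-- Triangle inequality about `cH`: `‖x‖ ≤ ‖x − cH‖ + ½`. -/
theorem norm_le_norm_sub_add_half_H (x : E5) : ‖x‖ ≤ ‖x - cH‖ + 1 / 2 := by
  rw [← norm_cH]
  calc ‖x‖ = ‖(x - cH) + cH‖ := by rw [sub_add_cancel]
    _ ≤ ‖x - cH‖ + ‖cH‖ := norm_add_le _ _

/-- Triangle inequality about `cG`: `‖x‖ ≤ ‖x − cG‖ + ½`. -/
theorem norm_le_norm_sub_add_half_G (x : E5) : ‖x‖ ≤ ‖x - cG‖ + 1 / 2 := by
  rw [← norm_cG]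
  calc ‖x‖ = ‖(x - cG) + cG‖ := by rw [sub_add_cancel]
    _ ≤ ‖x - cG‖ + ‖cG‖ := norm_add_le _ _

/-- Both profiles live inside the unit core `B₁` (where the terminal cut-off is `≡ 1`). -/
theorem norm_le_one_of_hU_ne_zero {x : E5} (hx : hU x ≠ 0) : ‖x‖ ≤ 1 := by
  have := norm_lt_of_bump_ne_zero n₁ n₂ hx
  linarith [norm_le_norm_sub_add_half_H x]

/-- `supp gU` lies in the unit core. -/
theorem norm_le_one_of_gU_ne_zero {x : E5} (hx : gU x ≠ 0) : ‖x‖ ≤ 1 := by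
  have := norm_lt_of_bump_ne_zero n₁ n₂ hx
  linarith [norm_le_norm_sub_add_half_G x]

/-- `∇hU = 0` off the unit core. -/
theorem fderiv_hU_eq_zero {x : E5} (hx : 1 < ‖x‖) : fderiv ℝ hU x = 0 :=
  fderiv_bump_eq_zero n₁ n₂ (by linarith [norm_le_norm_sub_add_half_H x])

/-- `∇gU = 0` off the unit core. -/
theorem fderiv_gU_eq_zero {x : E5} (hx : 1 < ‖x‖) : fderiv ℝ gU x = 0 :=
  fderiv_bump_eq_zero n₁ n₂ (by linarith [norm_le_norm_sub_add_half_G x])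

/-! ### E. The recovered strain of `gU` is continuous and NEGATIVE on the support of `hU` -/

/-- The joint integrand of `ψU · U[gU]`: continuous on `E5 × E5` (the kernel singularity `x = y` never
meets `supp ψU × supp gU`, by the `z`-gap). -/
theorem continuous_integrand :
    Continuous fun p : E5 × E5 => ψU p.1 * (KK (p.1 - p.2) * gU p.2) := by
  refine continuous_iff_continuousAt.2 fun p => ?_
  by_cases hp : ‖p.1 - cH‖ ≤ 1 / 3 ∧ ‖p.2 - cG‖ ≤ 1 / 5
  · have hne : p.1 - p.2 ≠ 0 := fun h0 => by
      have := zgap hp.1 hp.2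
      rw [h0] at this
      simp at this
    have hK : ContinuousAt (fun q : E5 × E5 => KK (q.1 - q.2)) p :=
      (continuousAt_KK hne).comp (f := fun q : E5 × E5 => q.1 - q.2) (by fun_prop)
    exact ((continuous_bump _ _ _).comp continuous_fst).continuousAt.mul
      (hK.mul ((continuous_bump _ _ _).comp continuous_snd).continuousAt)
  · rw [not_and_or, not_le, not_le] at hp
    refine (continuousAt_const : ContinuousAt (fun _ : E5 × E5 => (0 : ℝ)) p).congr ?_
    rcases hp with h1 | h2
    · have ev : ∀ᶠ q : E5 × E5 in 𝓝 p, ψU q.1 = (0 : E5 → ℝ) q.1 :=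
        (continuous_fst.tendsto p).eventually (bump_eventuallyEq_zero n₃ n₄ h1)
      exact ev.mono fun q hq => by simp [hq]
    · have ev : ∀ᶠ q : E5 × E5 in 𝓝 p, gU q.2 = (0 : E5 → ℝ) q.2 :=
        (continuous_snd.tendsto p).eventually (bump_eventuallyEq_zero n₁ n₂ h2)
      exact ev.mono fun q hq => by simp [hq]

/-- `ΦU = ψU · U[gU]`, written as ONE parametric integral with a jointly continuous, uniformly compactly
supported integrand. -/
def ΦU (x : E5) : ℝ := ∫ y, ψU x * (KK (x - y) * gU y)

/-- `ΦU = ψU · U[gU]` pointwise (the cut-off is a constant inside the integral). -/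
theorem ΦU_eq (x : E5) : ΦU x = ψU x * recoveredStrain gU x := by
  rw [ΦU, integral_const_mul]
  rfl

/-- `ΦU` is continuous (parametric integral of a jointly continuous integrand, uniformly compactly supported in the integration variable). -/
theorem continuous_ΦU : Continuous ΦU := by
  have h := continuousOn_integral_of_compact_support (μ := (volume : Measure E5)) (s := (univ : Set E5))
    (f := fun x y : E5 => ψU x * (KK (x - y) * gU y)) (isCompact_closedBall cG (1 / 5))
    continuous_integrand.continuousOn fun x y _ hy => by
      rw [mem_closedBall, dist_eq_norm, not_le] at hy
      have h0 : gU y = 0 := bump_eq_zero n₁ n₂ hy.le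
      simp [h0]
  exact continuousOn_univ.1 h

/-- Pointwise sign of the integrand: `ψU(x) K(x−y) gU(y) ≤ 0`. -/
theorem integrand_nonpos (x y : E5) : ψU x * (KK (x - y) * gU y) ≤ 0 := by
  by_cases hψ : ψU x = 0
  · simp [hψ]
  by_cases hg : gU y = 0
  · simp [hg]
  have hx := norm_lt_of_bump_ne_zero n₃ n₄ hψ
  have hy := norm_lt_of_bump_ne_zero n₁ n₂ hg
  have hK : KK (x - y) < 0 := KK_neg (zgap hx.le hy.le)
  exact mul_nonpos_iff.2 (Or.inl ⟨ψU_nonneg x, mul_nonpos_iff.2 (Or.inr ⟨hK.le, gU_nonneg y⟩)⟩)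

/-- `ΦU ≤ 0` everywhere. -/
theorem ΦU_nonpos (x : E5) : ΦU x ≤ 0 := integral_nonpos fun y => integrand_nonpos x y

/-- At the centre of the `H`-bump the recovered strain of `gU` is strictly negative. -/
theorem ΦU_cH_neg : ΦU cH < 0 := by
  have hc : Continuous fun y : E5 => ψU cH * (KK (cH - y) * gU y) :=
    (continuous_integrand.comp (show Continuous fun y : E5 => (cH, y) by fun_prop) :)
  have hs : HasCompactSupport fun y : E5 => -(ψU cH * (KK (cH - y) * gU y)) := by
    refine HasCompactSupport.intro (isCompact_closedBall cG (1 / 5)) fun y hy => ?_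
    rw [mem_closedBall, dist_eq_norm, not_le] at hy
    have h0 : gU y = 0 := bump_eq_zero n₁ n₂ hy.le
    simp [h0]
  have hψ : ψU cH = 1 := bump_eq_one n₃ n₄ (by simp)
  have hg : gU cG = 1 := bump_eq_one n₁ n₂ (by simp)
  have hK : KK (cH - cG) < 0 := KK_neg (by rw [PiLp.sub_apply, cH_four, cG_four]; norm_num)
  have hval : -(ψU cH * (KK (cH - cG) * gU cG)) ≠ 0 := by
    rw [hψ, hg]; simp [hK.ne]
  have hc' : Continuous fun y : E5 => -(ψU cH * (KK (cH - y) * gU y)) := hc.neg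
  have hpos := hc'.integral_pos_of_hasCompactSupport_nonneg_nonzero (μ := volume) hs
    (fun y => neg_nonneg.2 (integrand_nonpos cH y)) hval
  rw [integral_neg] at hpos
  simpa [ΦU] using hpos

/-! ### F. The source-density transfer `J₂[gU,hU] < 0` and the visibilities, for ANY cut-off `≡ 1` on `B₁` -/

section Cutoff

variable (χ : E5 → ℝ) (hχ : ∀ x : E5, ‖x‖ ≤ 1 → χ x = 1)
include hχ

/-- `J₂[gU,hU] = ∫ χ² U[gU] hU² = ∫ ΦU · hU²` — the cut-off is invisible on the core. -/
theorem transferH_eq : transferH χ gU hU = ∫ x, ΦU x * hU x ^ 2 := by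
  unfold transferH
  congr 1
  funext x
  by_cases hx : hU x = 0
  · simp [hx]
  · have hψ : ψU x = 1 := bump_eq_one n₃ n₄ (by linarith [norm_lt_of_bump_ne_zero n₁ n₂ hx])
    rw [hχ x (norm_le_one_of_hU_ne_zero hx), ΦU_eq, hψ]
    ring

/-- **The source-density transfer of the pair is strictly negative.** -/
theorem transferH_neg : transferH χ gU hU < 0 := by
  rw [transferH_eq χ hχ]
  have hc : Continuous fun x : E5 => -(ΦU x * hU x ^ 2) :=
    (continuous_ΦU.mul ((continuous_bump _ _ _).pow 2)).neg
  have hs : HasCompactSupport fun x : E5 => -(ΦU x * hU x ^ 2) := by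
    refine HasCompactSupport.intro (isCompact_closedBall cH (1 / 5)) fun x hx => ?_
    rw [mem_closedBall, dist_eq_norm, not_le] at hx
    have h0 : hU x = 0 := bump_eq_zero n₁ n₂ hx.le
    simp [h0]
  have h1 : hU cH = 1 := bump_eq_one n₁ n₂ (by simp)
  have hval : -(ΦU cH * hU cH ^ 2) ≠ 0 := by
    rw [h1]; simpa using ΦU_cH_neg.ne
  have hpos := hc.integral_pos_of_hasCompactSupport_nonneg_nonzero (μ := volume) hs
    (fun x => neg_nonneg.2 (mul_nonpos_iff.2 (Or.inr ⟨ΦU_nonpos x, sq_nonneg _⟩))) hval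
  rw [integral_neg] at hpos
  linarith

omit hχ in
/-- Visibilities are nonnegative: `V[g] ≥ 0`. -/
theorem visibility_nonneg (g : E5 → ℝ) : 0 ≤ visibility χ g :=
  add_nonneg (integral_nonneg fun x => by positivity) (integral_nonneg fun x => by positivity)

omit hχ in
/-- `∫ |∇hU|² > 0`: `hU` is smooth, compactly supported and not constant. -/
theorem integral_fderiv_hU_sq_pos : 0 < ∫ x, ‖fderiv ℝ hU x‖ ^ 2 := by
  have hc : Continuous fun x => ‖fderiv ℝ hU x‖ ^ 2 := (continuous_fderiv_bump _ _ _).norm.pow 2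
  have hs : HasCompactSupport fun x => ‖fderiv ℝ hU x‖ ^ 2 := by
    refine HasCompactSupport.intro (isCompact_closedBall cH (1 / 5)) fun x hx => ?_
    rw [mem_closedBall, dist_eq_norm, not_le] at hx
    have h0 : fderiv ℝ hU x = 0 := fderiv_bump_eq_zero n₁ n₂ hx
    simp [h0]
  obtain ⟨x₀, hx₀⟩ : ∃ x₀, fderiv ℝ hU x₀ ≠ 0 := by
    by_contra hall
    have hall' : ∀ x, fderiv ℝ hU x = 0 := fun x => not_not.1 (not_exists.1 hall x)
    have h := is_const_of_fderiv_eq_zero (differentiable_bump cH (1 / 10) (1 / 5)) hall' cH ((2 : ℝ) • e₄)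
    have h1 : hU cH = 1 := bump_eq_one n₁ n₂ (by simp)
    have h2 : hU ((2 : ℝ) • e₄) = 0 :=
      bump_eq_zero n₁ n₂ (by rw [cH, ← sub_smul, norm_smul_e₄]; norm_num)
    rw [hU_def] at h1 h2
    rw [h1, h2] at h
    norm_num at h
  exact hc.integral_pos_of_hasCompactSupport_nonneg_nonzero (μ := volume) hs (fun x => by positivity)
    (pow_ne_zero 2 (norm_ne_zero_iff.2 hx₀))

/-- **The entropy visibility of `hU` is strictly positive**: `W[hU] ≥ ∫ |∇hU|² > 0`. -/
theorem visibility_hU_pos : 0 < visibility χ hU := by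
  have h1 : ∫ x, χ x ^ 2 * ‖fderiv ℝ hU x‖ ^ 2 = ∫ x, ‖fderiv ℝ hU x‖ ^ 2 := by
    congr 1
    funext x
    by_cases hx : ‖x‖ ≤ 1
    · rw [hχ x hx]; ring
    · rw [fderiv_hU_eq_zero (not_le.1 hx)]; simp
  have h2 : 0 ≤ ∫ x, ‖fderiv ℝ χ x‖ ^ 2 * hU x ^ 2 := integral_nonneg fun x => by positivity
  unfold visibility
  rw [h1]
  linarith [integral_fderiv_hU_sq_pos]

end Cutoff

/-! ### G. Amplitude scaling: `𝔸 = 1`, `𝕁 > 0` -/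

/-- The elementary choice of amplitudes: given `V₁ ≥ 0`, `W₀ > 0`, `J₂ < 0`, `α, β > 0` and ANY `J₁`,
there are `a, b > 0` with `a²V₁ + βb²W₀ = 1` and `a³J₁ − αab²J₂ > 0` (take `a` small). -/
theorem scaling_algebra {V₁ W₀ J₁ J₂ α β : ℝ} (hV : 0 ≤ V₁) (hW : 0 < W₀) (hJ₂ : J₂ < 0)
    (hα : 0 < α) (hβ : 0 < β) :
    ∃ a b : ℝ, 0 < a ∧ 0 < b ∧ a ^ 2 * V₁ + β * (b ^ 2 * W₀) = 1 ∧
      0 < a ^ 3 * J₁ - α * (b ^ 2 * (a * J₂)) := by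
  set D : ℝ := α * (-J₂) / (β * W₀) with hD_def
  have hD : 0 < D := by rw [hD_def]; exact div_pos (mul_pos hα (neg_pos.2 hJ₂)) (mul_pos hβ hW)
  set c : ℝ := J₁ - V₁ * D with hc_def
  set t : ℝ := min (1 / (2 * (V₁ + 1))) (D / (2 * (|c| + 1))) with ht_def
  have ht : 0 < t := lt_min (by positivity) (by positivity)
  have ht1 : t * V₁ < 1 := by
    have h1 : t ≤ 1 / (2 * (V₁ + 1)) := min_le_left _ _
    have h2 : t * V₁ ≤ 1 / (2 * (V₁ + 1)) * V₁ := mul_le_mul_of_nonneg_right h1 hV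
    have h3 : 1 / (2 * (V₁ + 1)) * V₁ < 1 := by
      rw [div_mul_eq_mul_div, one_mul, div_lt_one (by positivity)]
      linarith
    linarith
  have ht2 : 0 < D + t * c := by
    have h1 : t ≤ D / (2 * (|c| + 1)) := min_le_right _ _
    have h2 : t * |c| ≤ D / (2 * (|c| + 1)) * |c| := mul_le_mul_of_nonneg_right h1 (abs_nonneg c)
    have h3 : D / (2 * (|c| + 1)) * |c| < D := by
      rw [div_mul_eq_mul_div, div_lt_iff₀ (by positivity)]
      nlinarith [abs_nonneg c]
    have h4 : -(t * |c|) ≤ t * c := by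
      have := neg_abs_le c
      nlinarith [ht.le]
    linarith
  refine ⟨Real.sqrt t, Real.sqrt ((1 - t * V₁) / (β * W₀)), Real.sqrt_pos.2 ht,
    Real.sqrt_pos.2 (div_pos (by linarith) (mul_pos hβ hW)), ?_, ?_⟩
  · rw [Real.sq_sqrt ht.le, Real.sq_sqrt (div_pos (by linarith) (mul_pos hβ hW)).le]
    field_simp
    ring
  · have ha : 0 < Real.sqrt t := Real.sqrt_pos.2 ht
    have e : Real.sqrt t ^ 3 * J₁ - α * (Real.sqrt ((1 - t * V₁) / (β * W₀)) ^ 2 * (Real.sqrt t * J₂)) =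
        Real.sqrt t * (D + t * c) := by
      rw [show Real.sqrt t ^ 3 = Real.sqrt t * Real.sqrt t ^ 2 by ring, Real.sq_sqrt ht.le,
        Real.sq_sqrt (div_pos (by linarith) (mul_pos hβ hW)).le, hc_def, hD_def]
      field_simp
      ring
    rw [e]
    exact mul_pos ha ht2

end Summit.NavierStokesRegularity.NavierStokesRegularity.Theorems.Shahmurov2026.Concrete

end

-- WHAT THIS IS NOT: not a claim about NS regularity or blow-up; not a claim about any author beyond the
-- typed locator.
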